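import Mathlib
import HarnessLib
import Summits.PneNP.PneNP.Theorems.CnfIdealGenLengthRankStability

/-!
# Crux `RankDefectRepresentations` (stmt-PneNP-18923), line `phantom-kernel`: EXACTIFICATION (tool of the lead)

Two reductions every attack on the hard stub S1 (`stub_contradictoryPhantoms`) uses, kernel-checked:

* `exists_idempotent_near` (cheap Fitting, constant `1`): every square matrix `A` over a field is within rank
  `rank (A² - A)` of an IDEMPOTENT matrix: `E := A ∘ π_W` with `W = ker (A² - A)` (an `A`-invariant subspace on
  which `A` is idempotent) and `π_W` a projection onto `W`; `A - E = A (1 - π_W)` has rank `≤ codim W`.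
* `finrank_le_finrank_inf_phantom_add` (phantoms survive perturbation): if every `M_i` is within rank `s` of
  `E_i`, then for every CNF `φ` and every subspace `U` killed by all clause words `Q_κ(M)`, `κ ∈ φ`, the part of
  `U` killed by all `Q_κ(E)` has codimension `≤ size φ · s` in `U` (the map `u ↦ (Q_κ(E) u)_κ` on `U` factors
  through `⊕_κ range (Q_κ(E) - Q_κ(M))`, and `rank (Q_κ(E) - Q_κ(M)) ≤ |κ| · s` by the landed telescoping
  `rank_clauseWordEval_sub_le`, p542939).
Together: a contradictory phantom `(M, U)` with axiom ranks `≤ t` yields one for EXACT idempotents `E`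
(`E_i² = E_i`, commutator ranks `≤ 5t`) of dimension `≥ dim U - size(φ) · t` for the read-off CNF `φ` — so S1 may
be attacked (or refuted) over exact idempotents without loss (`exact_phantom_of_phantom`).
HONEST FRAMING: elementary linear algebra; P ≠ NP is not moved; F-N2 is a FRONTIER formal rung.
-/

set_option linter.dupNamespace false -- `Summit.PneNP.PneNP.…`: summit = sub-problem name (D-0017)

namespace Summit.PneNP.PneNP.Theorems.CnfIdealGenLength

open Filter
open Literature.Computability.Complexity
open Literature.Computability.MetaComplexity
open Literature.Computability.MetaComplexity.NCIPS

section Fitting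

variable {K : Type} [Field K] {d : ℕ}

/-- **Cheap Fitting lemma (constant 1).** Every square matrix is within rank `rank (A·A - A)` of an idempotent
matrix. [folklore] -/
theorem exists_idempotent_near (A : Matrix (Fin d) (Fin d) K) :
    ∃ E : Matrix (Fin d) (Fin d) K, E * E = E ∧ (A - E).rank ≤ (A * A - A).rank := by
  classical
  -- the linear maps
  let a : (Fin d → K) →ₗ[K] (Fin d → K) := Matrix.toLin' A
  let nn : (Fin d → K) →ₗ[K] (Fin d → K) := Matrix.toLin' (A * A - A)
  let W : Submodule K (Fin d → K) := LinearMap.ker nn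
  have hnn : nn = a * a - a := by
    simp only [nn, a, map_sub, Matrix.toLin'_mul]; rfl
  -- `W` is `a`-invariant and `a` is idempotent on `W`
  have hcomm : a * nn = nn * a := by
    rw [hnn, mul_sub, sub_mul, mul_assoc]
  have hW : ∀ w ∈ W, a w ∈ W := by
    intro w hw
    rw [LinearMap.mem_ker] at hw ⊢
    have : nn (a w) = a (nn w) := by
      show (nn * a) w = (a * nn) w
      rw [hcomm]
    rw [this, hw, map_zero]
  have hid : ∀ w ∈ W, a (a w) = a w := by
    intro w hw
    have h0 : nn w = 0 := LinearMap.mem_ker.mp hw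
    rw [hnn] at h0
    simpa [sub_eq_zero] using h0
  -- a complement and the projection onto `W` along it
  obtain ⟨W', hWW'⟩ := W.exists_isCompl
  let π : (Fin d → K) →ₗ[K] (Fin d → K) := W.projection W' hWW'
  have hπW : ∀ x, π x ∈ W := fun x => Submodule.projection_apply_mem hWW' x
  have hπid : ∀ w ∈ W, π w = w := fun w hw => Submodule.projection_apply_of_mem_left hWW' hw
  -- the idempotent `E := A ∘ π`
  refine ⟨LinearMap.toMatrix' (a ∘ₗ π), ?_, ?_⟩
  · rw [← LinearMap.toMatrix'_mul]
    congr 1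
    apply LinearMap.ext
    intro x
    show a (π (a (π x))) = a (π x)
    rw [hπid _ (hW _ (hπW x)), hid _ (hπW x)]
  · -- `A - E = toMatrix' (a ∘ π')` with `π'` the projection onto `W'` along `W`; `finrank W' = rank (A² - A)`
    have hidπ : LinearMap.id - π = W'.projection W hWW'.symm := by
      rw [sub_eq_iff_eq_add, add_comm]; exact (Submodule.projection_add_projection_eq_id hWW').symm
    have hAE : A - LinearMap.toMatrix' (a ∘ₗ π) = LinearMap.toMatrix' (a ∘ₗ W'.projection W hWW'.symm) := by
      rw [← hidπ, LinearMap.comp_sub, LinearMap.comp_id, map_sub, LinearMap.toMatrix'_toLin']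
    rw [hAE]
    have hrank : ∀ g : (Fin d → K) →ₗ[K] (Fin d → K),
        (LinearMap.toMatrix' g).rank = Module.finrank K (LinearMap.range g) := by
      intro g
      show Module.finrank K (LinearMap.range (Matrix.mulVecLin (LinearMap.toMatrix' g))) = _
      rw [show Matrix.mulVecLin (LinearMap.toMatrix' g) = g from Matrix.toLin'_toMatrix' g]
    have hrk : (A * A - A).rank = Module.finrank K (LinearMap.range nn) := rfl
    rw [hrank, hrk]
    have hW' : Module.finrank K W' = Module.finrank K (LinearMap.range nn) := by
      have h1 := LinearMap.finrank_range_add_finrank_ker nn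
      have h2 := Submodule.finrank_add_eq_of_isCompl hWW'
      have h3 : Module.finrank K W = Module.finrank K (LinearMap.ker nn) := rfl
      omega
    rw [← hW', LinearMap.range_comp]
    refine (Submodule.finrank_map_le _ _).trans ?_
    rw [Submodule.range_projection]

end Fitting

section Perturbation

variable {K : Type} [Field K] {n d : ℕ}

/-- Unfolding the evaluation of a clause word at a matrix tuple. [folklore] -/
theorem lift_clauseWord_eq (M : Fin n → Matrix (Fin d) (Fin d) K) (κ : Clause (Fin n)) :
    MonoidAlgebra.lift K (Matrix (Fin d) (Fin d) K) (FreeMonoid (Fin n)) (FreeMonoid.lift M) (clauseWord K κ) =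
      (κ.map fun l => if l.2 then 1 - M l.1 else M l.1).prod := by
  induction κ with
  | nil => simp
  | cons l κ ih =>
    rw [clauseWord_cons, map_mul, ih, List.map_cons, List.prod_cons]
    congr 1
    unfold litWord
    split_ifs <;> simp [X]

/-- Membership in the common kernel of the clause words of `φ` at `M` (the phantom kernel), unfolded. -/
theorem mem_iInf_ker_clauseWord_iff (M : Fin n → Matrix (Fin d) (Fin d) K) (φ : CNF (Fin n))
    (u : Fin d → K) :
    u ∈ (⨅ κ ∈ φ, LinearMap.ker (Matrix.toLin'
      (MonoidAlgebra.lift K (Matrix (Fin d) (Fin d) K) (FreeMonoid (Fin n)) (FreeMonoid.lift M)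
        (clauseWord K κ))) : Submodule K (Fin d → K)) ↔
      ∀ κ ∈ φ, (MonoidAlgebra.lift K (Matrix (Fin d) (Fin d) K) (FreeMonoid (Fin n)) (FreeMonoid.lift M)
        (clauseWord K κ)).mulVec u = 0 := by
  simp [Submodule.mem_iInf, LinearMap.mem_ker, Matrix.toLin'_apply]

/-- One clause: the part of `U` killed by `Q_κ(E)` has codimension `≤ rank (Q_κ(E) - Q_κ(M))` in `U` when
`Q_κ(M)` kills `U`. [folklore] -/
theorem finrank_le_finrank_inf_ker_add (QM QE : Matrix (Fin d) (Fin d) K) (U : Submodule K (Fin d → K))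
    (hU : ∀ u ∈ U, QM.mulVec u = 0) :
    Module.finrank K U ≤ Module.finrank K (U ⊓ LinearMap.ker (Matrix.toLin' QE) : Submodule K (Fin d → K)) +
      (QE - QM).rank := by
  classical
  set g : (Fin d → K) →ₗ[K] (Fin d → K) := Matrix.toLin' QE with hg
  -- rank-nullity for `g ∘ U.subtype`
  have h1 := LinearMap.finrank_range_add_finrank_ker (g ∘ₗ U.subtype)
  have hker : Module.finrank K (LinearMap.ker (g ∘ₗ U.subtype)) =
      Module.finrank K (U ⊓ LinearMap.ker g : Submodule K (Fin d → K)) := by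
    rw [LinearMap.ker_comp, ← Submodule.map_comap_subtype]
    exact (LinearEquiv.finrank_eq (Submodule.equivMapOfInjective U.subtype U.injective_subtype _))
  have hrange : Module.finrank K (LinearMap.range (g ∘ₗ U.subtype)) ≤ (QE - QM).rank := by
    unfold Matrix.rank
    apply Submodule.finrank_mono
    rintro _ ⟨u, rfl⟩
    refine ⟨(u : Fin d → K), ?_⟩
    simp only [LinearMap.coe_comp, Function.comp_apply, Submodule.coe_subtype, Matrix.mulVecLin_apply,
      Matrix.sub_mulVec, hU u u.2, sub_zero, hg, Matrix.toLin'_apply]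
  have h2 : Module.finrank K U = Module.finrank K (LinearMap.ker (g ∘ₗ U.subtype)) +
      Module.finrank K (LinearMap.range (g ∘ₗ U.subtype)) := by
    have := Module.finrank_fin_fun K (n := d)
    omega
  rw [h2, hker]
  exact Nat.add_le_add_left hrange _

/-- **Phantoms survive perturbation.** If every `M_i` is within rank `s` of `E_i`, then for every CNF `φ` and
every subspace `U` killed by all clause words `Q_κ(M)`, `κ ∈ φ`, the part of `U` killed by all `Q_κ(E)` has
codimension at most `size φ · s` in `U`. [folklore] -/
theorem finrank_le_finrank_inf_phantom_add (M E : Fin n → Matrix (Fin d) (Fin d) K) {s : ℕ}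
    (hs : ∀ i, (M i - E i).rank ≤ s) (φ : CNF (Fin n)) (U : Submodule K (Fin d → K))
    (hU : ∀ κ ∈ φ, ∀ u ∈ U, (MonoidAlgebra.lift K (Matrix (Fin d) (Fin d) K) (FreeMonoid (Fin n))
      (FreeMonoid.lift M) (clauseWord K κ)).mulVec u = 0) :
    Module.finrank K U ≤ Module.finrank K (U ⊓ ⨅ κ ∈ φ, LinearMap.ker (Matrix.toLin'
      (MonoidAlgebra.lift K (Matrix (Fin d) (Fin d) K) (FreeMonoid (Fin n)) (FreeMonoid.lift E)
        (clauseWord K κ))) : Submodule K (Fin d → K)) + φ.size * s := by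
  induction φ generalizing U with
  | nil =>
    have h : (U ⊓ ⨅ κ ∈ ([] : CNF (Fin n)), LinearMap.ker (Matrix.toLin'
        (MonoidAlgebra.lift K (Matrix (Fin d) (Fin d) K) (FreeMonoid (Fin n)) (FreeMonoid.lift E)
          (clauseWord K κ))) : Submodule K (Fin d → K)) = U :=
      le_antisymm inf_le_left (le_inf le_rfl fun u _ => (mem_iInf_ker_clauseWord_iff E [] u).mpr (by simp))
    rw [h]; simp [CNF.size]
  | cons κ φ ih =>
    -- first clause
    have hκ := finrank_le_finrank_inf_ker_add
      (MonoidAlgebra.lift K (Matrix (Fin d) (Fin d) K) (FreeMonoid (Fin n)) (FreeMonoid.lift M) (clauseWord K κ))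
      (MonoidAlgebra.lift K (Matrix (Fin d) (Fin d) K) (FreeMonoid (Fin n)) (FreeMonoid.lift E) (clauseWord K κ))
      U (hU κ (by simp))
    have hrk : (MonoidAlgebra.lift K (Matrix (Fin d) (Fin d) K) (FreeMonoid (Fin n)) (FreeMonoid.lift E)
          (clauseWord K κ) -
        MonoidAlgebra.lift K (Matrix (Fin d) (Fin d) K) (FreeMonoid (Fin n)) (FreeMonoid.lift M)
          (clauseWord K κ)).rank ≤ κ.length * s := by
      rw [lift_clauseWord_eq, lift_clauseWord_eq]
      refine (rank_clauseWordEval_sub_le E M κ).trans ?_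
      have : ∀ l ∈ κ, (E l.1 - M l.1).rank ≤ s := fun l _ => by
        rw [← rank_neg_eq, neg_sub]; exact hs l.1
      calc (κ.map fun l => (E l.1 - M l.1).rank).sum ≤ (κ.map fun _ => s).sum :=
            List.sum_le_sum (fun l hl => this l hl)
        _ = κ.length * s := by simp
    -- the remaining clauses, applied to `U ⊓ ker Q_κ(E)`
    set U₁ : Submodule K (Fin d → K) := U ⊓ LinearMap.ker (Matrix.toLin'
      (MonoidAlgebra.lift K (Matrix (Fin d) (Fin d) K) (FreeMonoid (Fin n)) (FreeMonoid.lift E)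
        (clauseWord K κ))) with hU₁
    have hU₁' : ∀ κ' ∈ φ, ∀ u ∈ U₁, (MonoidAlgebra.lift K (Matrix (Fin d) (Fin d) K) (FreeMonoid (Fin n))
        (FreeMonoid.lift M) (clauseWord K κ')).mulVec u = 0 :=
      fun κ' hκ' u hu => hU κ' (by simp [hκ']) u (Submodule.mem_inf.mp hu).1
    have ih' := ih U₁ hU₁'
    -- `U₁ ⊓ ⨅_{φ} = U ⊓ ⨅_{κ :: φ}`
    have hinf : (U₁ ⊓ ⨅ κ' ∈ φ, LinearMap.ker (Matrix.toLin'
        (MonoidAlgebra.lift K (Matrix (Fin d) (Fin d) K) (FreeMonoid (Fin n)) (FreeMonoid.lift E)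
          (clauseWord K κ'))) : Submodule K (Fin d → K)) =
        U ⊓ ⨅ κ' ∈ κ :: φ, LinearMap.ker (Matrix.toLin'
          (MonoidAlgebra.lift K (Matrix (Fin d) (Fin d) K) (FreeMonoid (Fin n)) (FreeMonoid.lift E)
            (clauseWord K κ'))) := by
      ext u
      rw [Submodule.mem_inf, Submodule.mem_inf, Submodule.mem_inf, mem_iInf_ker_clauseWord_iff,
        mem_iInf_ker_clauseWord_iff, LinearMap.mem_ker, Matrix.toLin'_apply]
      constructor
      · rintro ⟨⟨huU, huκ⟩, hφ⟩
        refine ⟨huU, fun κ' hκ' => ?_⟩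
        rcases List.mem_cons.mp hκ' with rfl | h
        · exact huκ
        · exact hφ κ' h
      · rintro ⟨huU, hall⟩
        exact ⟨⟨huU, hall κ (List.mem_cons_self ..)⟩, fun κ' hκ' => hall κ' (List.mem_cons_of_mem κ hκ')⟩
    rw [hinf] at ih'
    calc Module.finrank K U ≤ Module.finrank K U₁ + κ.length * s := hκ.trans (Nat.add_le_add_left hrk _)
      _ ≤ _ + CNF.size φ * s + κ.length * s := Nat.add_le_add_right ih' _
      _ = _ + CNF.size (κ :: φ) * s := by
          simp only [CNF.size, List.map_cons, List.sum_cons]; ring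

end Perturbation

section Exact

variable {K : Type} [Field K] {n d : ℕ}

/-- **Exactification of phantoms.** From an almost-representation `M` (axiom ranks `≤ t`) and a subspace `U`
killed by the clause words of `φ` at `M`, one gets EXACT idempotents `E` (`E_i² = E_i`), still an
almost-representation (axiom ranks `≤ 5t`), coordinatewise within rank `t` of `M`, such that the part of `U`
killed by the clause words of `φ` at `E` has codimension `≤ size φ · t` in `U`.  So the hard stub S1 of the line
`phantom-kernel` (and any refutation of it) may assume exact idempotents. [folklore] -/
theorem exact_phantom_of_phantom (M : Fin n → Matrix (Fin d) (Fin d) K) (t : ℕ)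
    (hax : ∀ g : MonoidAlgebra K (FreeMonoid (Fin n)), IsAxiom g →
      (MonoidAlgebra.lift K (Matrix (Fin d) (Fin d) K) (FreeMonoid (Fin n)) (FreeMonoid.lift M) g).rank ≤ t)
    (φ : CNF (Fin n)) (U : Submodule K (Fin d → K))
    (hU : ∀ κ ∈ φ, ∀ u ∈ U, (MonoidAlgebra.lift K (Matrix (Fin d) (Fin d) K) (FreeMonoid (Fin n))
      (FreeMonoid.lift M) (clauseWord K κ)).mulVec u = 0) :
    ∃ E : Fin n → Matrix (Fin d) (Fin d) K, (∀ i, E i * E i = E i) ∧ (∀ i, (M i - E i).rank ≤ t) ∧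
      (∀ g : MonoidAlgebra K (FreeMonoid (Fin n)), IsAxiom g →
        (MonoidAlgebra.lift K (Matrix (Fin d) (Fin d) K) (FreeMonoid (Fin n)) (FreeMonoid.lift E) g).rank
          ≤ 5 * t) ∧
      Module.finrank K U ≤ Module.finrank K (U ⊓ ⨅ κ ∈ φ, LinearMap.ker (Matrix.toLin'
        (MonoidAlgebra.lift K (Matrix (Fin d) (Fin d) K) (FreeMonoid (Fin n)) (FreeMonoid.lift E)
          (clauseWord K κ))) : Submodule K (Fin d → K)) + φ.size * t := by
  choose E hE hEr using fun i => exists_idempotent_near (M i)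
  have hbool : ∀ i, (M i * M i - M i).rank ≤ t := fun i => by
    have := hax (X K i * X K i - X K i) (Or.inl ⟨i, rfl⟩)
    simpa [X] using this
  have hcomm : ∀ i j, i ≠ j → (M i * M j - M j * M i).rank ≤ t := fun i j hij => by
    have := hax (X K i * X K j - X K j * X K i) (Or.inr ⟨i, j, hij, rfl⟩)
    simpa [X] using this
  have hdist : ∀ i, (M i - E i).rank ≤ t := fun i => (hEr i).trans (hbool i)
  have hdist' : ∀ i, (E i - M i).rank ≤ t := fun i => by rw [← rank_neg_eq, neg_sub]; exact hdist i
  refine ⟨E, hE, hdist, ?_, finrank_le_finrank_inf_phantom_add M E hdist φ U hU⟩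
  intro g hg
  rcases hg with ⟨i, rfl⟩ | ⟨i, j, hij, rfl⟩
  · have : MonoidAlgebra.lift K (Matrix (Fin d) (Fin d) K) (FreeMonoid (Fin n)) (FreeMonoid.lift E)
        (X K i * X K i - X K i) = 0 := by simp [X, hE i]
    rw [this, Matrix.rank_zero]; exact Nat.zero_le _
  · have hev : MonoidAlgebra.lift K (Matrix (Fin d) (Fin d) K) (FreeMonoid (Fin n)) (FreeMonoid.lift E)
        (X K i * X K j - X K j * X K i) = E i * E j - E j * E i := by simp [X]
    rw [hev]
    -- `[E_i, E_j] = [M_i, M_j] + (E_i (E_j - M_j) + (E_i - M_i) M_j) - (E_j (E_i - M_i) + (E_j - M_j) M_i)`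
    have hsplit : E i * E j - E j * E i = (M i * M j - M j * M i) +
        ((E i * (E j - M j) + (E i - M i) * M j) - (E j * (E i - M i) + (E j - M j) * M i)) := by
      noncomm_ring
    rw [hsplit]
    have r1 : (E i * (E j - M j) + (E i - M i) * M j).rank ≤ t + t :=
      (Literature.Computability.AlgebraicComplexity.rank_add_le _ _).trans (Nat.add_le_add
        ((Matrix.rank_mul_le_right _ _).trans (hdist' j)) ((Matrix.rank_mul_le_left _ _).trans (hdist' i)))
    have r2 : (E j * (E i - M i) + (E j - M j) * M i).rank ≤ t + t :=
      (Literature.Computability.AlgebraicComplexity.rank_add_le _ _).trans (Nat.add_le_add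
        ((Matrix.rank_mul_le_right _ _).trans (hdist' i)) ((Matrix.rank_mul_le_left _ _).trans (hdist' j)))
    have r3 : ((E i * (E j - M j) + (E i - M i) * M j) - (E j * (E i - M i) + (E j - M j) * M i)).rank ≤
        (t + t) + (t + t) := by
      rw [sub_eq_add_neg]
      refine (Literature.Computability.AlgebraicComplexity.rank_add_le _ _).trans (Nat.add_le_add r1 ?_)
      rw [rank_neg_eq]; exact r2
    calc _ ≤ (M i * M j - M j * M i).rank + ((t + t) + (t + t)) :=
          (Literature.Computability.AlgebraicComplexity.rank_add_le _ _).trans (Nat.add_le_add_left r3 _)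
      _ ≤ t + ((t + t) + (t + t)) := Nat.add_le_add_right (hcomm i j hij) _
      _ = 5 * t := by ring

end Exact


end Summit.PneNP.PneNP.Theorems.CnfIdealGenLength
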